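import Summits.KontsevichZagierPeriods.KontsevichZagierPeriods.Theses.HurwitzMicroSectors
import Summits.KontsevichZagierPeriods.KontsevichZagierPeriods.Theorems.HurwitzMicroSectorsNormalFormPrinciplePiBoxTransfer
import Summits.KontsevichZagierPeriods.KontsevichZagierPeriods.Theorems.HurwitzMicroSectorsNormalFormPrincipleVariants2238
import Summits.KontsevichZagierPeriods.KontsevichZagierPeriods.Theorems.HurwitzMicroSectorsNormalFormPrincipleVariants2232
import Summits.KontsevichZagierPeriods.KontsevichZagierPeriods.Theorems.HurwitzMicroSectorsNormalFormPrincipleVariants2234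

/-! TTRL-lite variant V2336 of stmt-KontsevichZagierPeriods-3869

Variant V2336 = `stub_boxRigidity` (the leaf `BoxRigidity` of `NormalFormPrinciple`: two representations
on open unit boxes with integrands of KZ's rational shape `p/q`, `p, q` over `ℚ`, and equal values are
KZ-equivalent) under the TWO-sided small-case move `bound_nat:m≤8; bound_nat:m'≤8` (both dimensions
bounded by `8`; the hypotheses arrive in the order `m' ≤ 8 → m ≤ 8`). Verdict of the attempt seat:
**open** — this file is the exact-strength certificate, not a proof of the variant:
* `stub_boxRigidity_var2336_iff_boxVanishing_eight`: V2336 ⟺ **BoxVanishing 8** — every box-rational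
  representation on `(0,1)⁸` of value `0` is a relation (⇒: the pair `(8, 8)` is allowed, compare with the
  zero representation, `boxVanishingDim_left_of_pair 8 8`; ⇐: pad both sides to the `8`-box and subtract
  there, `boxRigidityLe_of_boxVanishingDim 8`; both tree, `…Variants2238`);
* `stub_boxRigidity_var2336_iff_var2232`, `stub_boxRigidity_var2336_iff_var2234`: V2336 ⟺ the siblings
  V2232 (`fix_nat:m=2; fix_nat:m'=8`) and V2234 (`bound_nat:m≤2; bound_nat:m'≤8`) — all three are
  `BoxVanishing 8`; bounding, freezing or swapping the two dimension hypotheses changes nothing;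
* `boxVanishing_le_eight_of_stub_boxRigidity_var2336`: V2336 contains BoxVanishing `j` for every `j ≤ 8`,
  in particular BoxVanishing 2 (every vanishing `ℚ`-combination of absolutely convergent `∫_{(0,1)²} P/Q` —
  `π²`, `log a · log b`, Catalan's `G`, `Li₂` at rationals, … — is generated by the four moves: open; the
  route closes the level-`4` rung only under the open hypothesis `Indep_ℚ(1, π², G)`) and BoxVanishing
  3, 5, 7 (`ζ(3)`, `ζ(5)`, `ζ(7)`, MZVs of weight `≤ 8`) — nothing in the tree or in print proves that;
* `stub_boxRigidity_var2336_of_parent` / `_of_statement`: Summit ⇒ parent ⇒ V2336, so a refutation of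
  the variant would refute Conjecture 1 for the tree's calculus — the variant is neither provable nor
  refutable from the tree.
Source: M. Kontsevich, D. Zagier, *Periods* (2001), §1.2 Conjecture 1. Pure proof file, no definitions. -/

-- `Summit.<Summit>.<Problem>` is the tree's mandated summit-side namespace (CONVENTIONS §2); for this
-- single-conjunct summit the two coincide, so the duplicate is deliberate.
set_option linter.dupNamespace false

noncomputable section

namespace Summit.KontsevichZagierPeriods.KontsevichZagierPeriods.Theorems

open MeasureTheory Set
open Literature.NumberTheory.Transcendental Literature.NumberTheory.Transcendental.KZ
open Summit.KontsevichZagierPeriods.KontsevichZagierPeriods.Theses.HurwitzMicroSectors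
open Summit.KontsevichZagierPeriods.HurwitzMicroSectors.NormalFormPrinciple.PiBox

/-! ## The variant V2336: Conjecture 1 for box-rational periods of dimensions `m, m' ≤ 8` -/

/-- **V2336 ⟺ BoxVanishing in dimension `8`** (every box-rational representation on `(0,1)⁸` of value
`0` is a relation): (⇒) the pair of dimensions `(8, 8)` is allowed by the variant, so compare a vanishing
box-rational representation on `(0,1)⁸` with the zero representation there
(`boxVanishingDim_left_of_pair 8 8`); (⇐) pad both representations to the `8`-box and subtract there
(`boxRigidityLe_of_boxVanishingDim 8`). [cite: KontsevichZagier2001, §1.2 Conjecture 1] -/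
theorem stub_boxRigidity_var2336_iff_boxVanishing_eight :
    (∀ (m m' : ℕ) (N : IntegralRep m) (N' : IntegralRep m'), m' ≤ 8 → m ≤ 8 → N.domain = {x | ∀ i, x i ∈ Set.Ioo (0:ℝ) 1} → N.IsRational → N'.domain = {x | ∀ i, x i ∈ Set.Ioo (0:ℝ) 1} → N'.IsRational → N.value = N'.value → Equivalent N N') ↔
    (∀ (M : IntegralRep 8), M.domain = {x | ∀ i, x i ∈ Set.Ioo (0:ℝ) 1} → M.IsRational →
      M.value = 0 → of M ∈ relations) :=
  ⟨fun h => boxVanishingDim_left_of_pair 8 8 fun N N' => h 8 8 N N' le_rfl le_rfl,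
    fun hvan m m' N N' hm' hm => boxRigidityLe_of_boxVanishingDim 8 hvan m m' N N' hm hm'⟩

/-- **V2336 ⟺ BoxRigidity for all dimensions `m, m' ≤ 8` with the hypotheses in the other order**
(the right-hand side of `stub_boxRigidity_var2232_iff_le_eight`; a pure reordering).
[cite: KontsevichZagier2001, §1.2 Conjecture 1] -/
theorem stub_boxRigidity_var2336_iff_le_eight :
    (∀ (m m' : ℕ) (N : IntegralRep m) (N' : IntegralRep m'), m' ≤ 8 → m ≤ 8 → N.domain = {x | ∀ i, x i ∈ Set.Ioo (0:ℝ) 1} → N.IsRational → N'.domain = {x | ∀ i, x i ∈ Set.Ioo (0:ℝ) 1} → N'.IsRational → N.value = N'.value → Equivalent N N') ↔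
    (∀ (m m' : ℕ) (N : IntegralRep m) (N' : IntegralRep m'), m ≤ 8 → m' ≤ 8 →
      N.domain = {x | ∀ i, x i ∈ Set.Ioo (0:ℝ) 1} → N.IsRational →
      N'.domain = {x | ∀ i, x i ∈ Set.Ioo (0:ℝ) 1} → N'.IsRational →
      N.value = N'.value → Equivalent N N') :=
  ⟨fun h m m' N N' hm hm' => h m m' N N' hm' hm, fun h m m' N N' hm' hm => h m m' N N' hm hm'⟩

/-- **V2336 ⟺ V2232** (the sibling `fix_nat:m=2; fix_nat:m'=8`, file `…Variants2232`): both are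
`BoxVanishing 8`. [cite: KontsevichZagier2001, §1.2 Conjecture 1] -/
theorem stub_boxRigidity_var2336_iff_var2232 :
    (∀ (m m' : ℕ) (N : IntegralRep m) (N' : IntegralRep m'), m' ≤ 8 → m ≤ 8 → N.domain = {x | ∀ i, x i ∈ Set.Ioo (0:ℝ) 1} → N.IsRational → N'.domain = {x | ∀ i, x i ∈ Set.Ioo (0:ℝ) 1} → N'.IsRational → N.value = N'.value → Equivalent N N') ↔
    (∀ (N : IntegralRep 2) (N' : IntegralRep 8), N.domain = {x | ∀ i, x i ∈ Set.Ioo (0:ℝ) 1} →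
      N.IsRational → N'.domain = {x | ∀ i, x i ∈ Set.Ioo (0:ℝ) 1} → N'.IsRational →
      N.value = N'.value → Equivalent N N') := by
  rw [stub_boxRigidity_var2336_iff_boxVanishing_eight, stub_boxRigidity_var2232_iff_boxVanishing_eight]

/-- **V2336 ⟺ V2234** (the sibling `bound_nat:m≤2; bound_nat:m'≤8`, file `…Variants2234`): both are
`BoxVanishing 8`. [cite: KontsevichZagier2001, §1.2 Conjecture 1] -/
theorem stub_boxRigidity_var2336_iff_var2234 :
    (∀ (m m' : ℕ) (N : IntegralRep m) (N' : IntegralRep m'), m' ≤ 8 → m ≤ 8 → N.domain = {x | ∀ i, x i ∈ Set.Ioo (0:ℝ) 1} → N.IsRational → N'.domain = {x | ∀ i, x i ∈ Set.Ioo (0:ℝ) 1} → N'.IsRational → N.value = N'.value → Equivalent N N') ↔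
    (∀ (m m' : ℕ) (N : IntegralRep m) (N' : IntegralRep m'), m' ≤ 8 → m ≤ 2 →
      N.domain = {x | ∀ i, x i ∈ Set.Ioo (0:ℝ) 1} → N.IsRational →
      N'.domain = {x | ∀ i, x i ∈ Set.Ioo (0:ℝ) 1} → N'.IsRational →
      N.value = N'.value → Equivalent N N') := by
  rw [stub_boxRigidity_var2336_iff_boxVanishing_eight, stub_boxRigidity_var2234_iff_boxVanishing_eight]

/-- **V2336 ⇒ BoxVanishing in every dimension `j ≤ 8`** (monotonicity in the dimension, by padding):
in particular the dimension-`2` statement (all `ℚ`-relations among absolutely convergent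
`∫_{(0,1)²} P/Q` are generated by the moves) and the dimension-`3` one (`ζ(3)`, `π³`, `Li₃` values, …).
[cite: KontsevichZagier2001, §1.2 Conjecture 1] -/
theorem boxVanishing_le_eight_of_stub_boxRigidity_var2336
    (h : ∀ (m m' : ℕ) (N : IntegralRep m) (N' : IntegralRep m'), m' ≤ 8 → m ≤ 8 → N.domain = {x | ∀ i, x i ∈ Set.Ioo (0:ℝ) 1} → N.IsRational → N'.domain = {x | ∀ i, x i ∈ Set.Ioo (0:ℝ) 1} → N'.IsRational → N.value = N'.value → Equivalent N N')
    {j : ℕ} (hj : j ≤ 8) (N : IntegralRep j) (hNd : N.domain = {x | ∀ i, x i ∈ Set.Ioo (0:ℝ) 1})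
    (hNr : N.IsRational) (hv : N.value = 0) : of N ∈ relations :=
  boxVanishingDim_mono hj (stub_boxRigidity_var2336_iff_boxVanishing_eight.1 h) N hNd hNr hv

/-- **The parent leaf ⇒ V2336** (the variant is a specialisation of `stub_boxRigidity`; the converse is
not claimed — the parent is BoxVanishing in ALL dimensions). [cite: KontsevichZagier2001, §1.2 Conjecture 1] -/
theorem stub_boxRigidity_var2336_of_parent
    (h : ∀ (m m' : ℕ) (N : IntegralRep m) (N' : IntegralRep m'), N.domain = {x | ∀ i, x i ∈ Set.Ioo (0:ℝ) 1} → N.IsRational → N'.domain = {x | ∀ i, x i ∈ Set.Ioo (0:ℝ) 1} → N'.IsRational → N.value = N'.value → Equivalent N N') :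
    ∀ (m m' : ℕ) (N : IntegralRep m) (N' : IntegralRep m'), m' ≤ 8 → m ≤ 8 → N.domain = {x | ∀ i, x i ∈ Set.Ioo (0:ℝ) 1} → N.IsRational → N'.domain = {x | ∀ i, x i ∈ Set.Ioo (0:ℝ) 1} → N'.IsRational → N.value = N'.value → Equivalent N N' :=
  fun m m' N N' _ _ => h m m' N N'

/-- **`KontsevichZagierPeriods ⇒ V2336`**: the variant is a special case of Conjecture 1 for the
tree's calculus (`leaves_of_statement`) — so a refutation of the variant would refute the Summit.
[cite: KontsevichZagier2001, §1.2 Conjecture 1] -/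
theorem stub_boxRigidity_var2336_of_statement (h : _root_.KontsevichZagierPeriods) :
    ∀ (m m' : ℕ) (N : IntegralRep m) (N' : IntegralRep m'), m' ≤ 8 → m ≤ 8 → N.domain = {x | ∀ i, x i ∈ Set.Ioo (0:ℝ) 1} → N.IsRational → N'.domain = {x | ∀ i, x i ∈ Set.Ioo (0:ℝ) 1} → N'.IsRational → N.value = N'.value → Equivalent N N' :=
  stub_boxRigidity_var2336_of_parent (leaves_of_statement h).1

end Summit.KontsevichZagierPeriods.KontsevichZagierPeriods.Theorems

end
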